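import Summits.ResolutionOfSingularities.ResolutionOfSingularities.Theorems.WeightedInvariantLocalWeightedDropNCDirectrixCutWeierstrass

/-! # The Weierstrass witness in LETTER position (every `m`, every order)

Helper for W4.3 / crux `stmt-ResolutionOfSingularities-8899` (`WeightedInvariant.LocalWeightedDrop`), line `directrix-cut`, second layer: the leaf
`stub_unaryLetterEscapeThree` of the unary position split starts from a unary vertex whose directrix form IS a boundary letter `x_l`
(`Decoration.LetterDir δ l`: `O = ∅`, `l ∈ E`, `in_o f = λ·x_l^o`).  This file provides its presentation: the transposition `x_0 ↔ x_l` is a legal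
count move sending the letter `l` to the slot `0` and every OTHER boundary letter to a coordinate hyperplane `x_{l''}`, `l'' ≠ 0`, after which `f` is
`x₀`-regular of order `o` and Weierstrass preparation in the slot `0` (`exists_weierstrass_of_regular`, sibling file …NCDirectrixCutWeierstrass) gives
`Φ^* f = u · (x₀^o + Σ_{i<o} a_i x₀^i)`, `u` a unit, the `a_i` free of `x₀` — the letter threefold `W = V(x_l)` becomes `V(x₀)` and the `a_i` are the
data of the idealistic exponent `((a_i, o − i))_{i<o}` on `W` (OURS reading; the engine on `W` is the leaf's business).  Proofs are the LETTER twins of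
`Decoration.exists_perm_of_goodDir` / `exists_regularMove_of_goodDir` / `exists_weierstrassWitness_of_goodDir` (same file), with the free slot `j ∉ E`
replaced by the letter `l` itself.
[OURS · strategist res-L1-w43-strat-1 gen 10 · `--supports stmt-ResolutionOfSingularities-8899 --as helper` · def-free · nothing of any manuscript]
-/

noncomputable section

set_option linter.dupNamespace false -- mandated namespace of this single-conjunct summit

namespace Summit.ResolutionOfSingularities.ResolutionOfSingularities.Theorems

namespace TameFourTupleDrop

open MvPowerSeries Literature.AlgebraicGeometry.Resolution

variable {k : Type} [Field k] {m : ℕ}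

/-- **LETTER POSITION ⇒ THE TRANSPOSITION `x_0 ↔ x_l` MAKES `f` `x₀`-REGULAR OF ORDER `o`**, sends the letter `l` to the slot `0` and every other
boundary letter off the slot `0`. -/
theorem Decoration.exists_perm_of_letterDir {δ : Decoration k m} {l : Fin (m + 1)} (hL : δ.LetterDir l) (ho : δ.o ≠ 0) :
    ∃ σ : Equiv.Perm (Fin (m + 1)), σ l = 0 ∧ (∀ l' ∈ δ.E, l' ≠ l → σ l' ≠ 0) ∧
      coeff (Finsupp.single 0 δ.o) (subst (fun i => (X (σ i) : MvPowerSeries (Fin (m + 1)) k)) δ.f) ≠ 0 := by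
  classical
  obtain ⟨hO, -, hℓ⟩ := hL
  have hc : δ.c = δ.o := by rw [Decoration.c, hO, Finset.card_empty, Nat.add_zero]
  have hc0 : δ.c ≠ 0 := by rw [hc]; exact ho
  have hcoef : coeff (Finsupp.single l δ.o) δ.f ≠ 0 := by
    have hl1 : (Pi.single l (1 : k) : Fin (m + 1) → k) l ≠ 0 := by
      rw [Pi.single_eq_same]; exact one_ne_zero
    have h : ¬ coeff (Finsupp.single l δ.c) (δ.f * ∏ x ∈ δ.O, X x) = 0 := fun h0 => hl1 ((hℓ.apply_eq_zero_iff_coeff hc0 l).mpr h0)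
    rwa [hO, Finset.prod_empty, mul_one, hc] at h
  refine ⟨Equiv.swap l 0, Equiv.swap_apply_left l 0, fun l' _ hne h => ?_, ?_⟩
  · rw [Equiv.swap_apply_eq_iff, Equiv.swap_apply_right] at h
    exact hne h
  · have key := coeff_embDomain_rename (R := k) (Equiv.swap l (0 : Fin (m + 1))).toEmbedding δ.f (Finsupp.single l δ.o)
    rw [Finsupp.embDomain_single, Equiv.toEmbedding_apply, Equiv.swap_apply_left] at key
    have hsub : subst (fun i => (X ((Equiv.swap l (0 : Fin (m + 1))) i) : MvPowerSeries (Fin (m + 1)) k)) δ.f =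
        rename (⇑(Equiv.swap l (0 : Fin (m + 1))).toEmbedding) δ.f :=
      (rename_eq_subst _ δ.f).symm
    rw [hsub, key]
    exact hcoef

/-- The same, packaged as LEGAL-MOVE DATA: a legal `Φ` (a transposition of coordinates) with `Φ l = X 0`, every other boundary letter
`Φ l' = v · X l''`, `l'' ≠ 0`, `v` a unit, `ord Φ^* f = ord f`, and `Φ^* f` `x₀`-regular of order `o`. -/
theorem Decoration.exists_regularMove_of_letterDir {δ : Decoration k m} {l : Fin (m + 1)} (hL : δ.LetterDir l) (ho : δ.o ≠ 0) :
    ∃ Φ : Fin (m + 1) → MvPowerSeries (Fin (m + 1)) k,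
      (∀ i, constantCoeff (Φ i) = 0) ∧
      IsUnit (Matrix.det (Matrix.of fun i j : Fin (m + 1) => coeff (Finsupp.single j 1) (Φ i))) ∧
      Φ l = X 0 ∧
      (∀ l' ∈ δ.E, l' ≠ l → ∃ (l'' : Fin (m + 1)) (v : MvPowerSeries (Fin (m + 1)) k), l'' ≠ 0 ∧ constantCoeff v ≠ 0 ∧ Φ l' = v * X l'') ∧
      (subst Φ δ.f).order = δ.f.order ∧
      coeff (Finsupp.single 0 δ.o) (subst Φ δ.f) ≠ 0 := by
  obtain ⟨σ, hl0, hE, hcoef⟩ := Decoration.exists_perm_of_letterDir hL ho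
  obtain ⟨h0, hdet⟩ := isLegal_X_perm (k := k) σ
  refine ⟨fun i => X (σ i), h0, hdet, by simp only [hl0], fun l' hl' hne => ⟨σ l', 1, hE l' hl' hne, ?_, (one_mul _).symm⟩,
    TOT2E1.order_subst_eq_of_legal _ h0 hdet δ.f, hcoef⟩
  rw [map_one]
  exact one_ne_zero

/-- **THE WEIERSTRASS WITNESS IN LETTER POSITION** (every `m`, every order): a legal count move `Φ` (a transposition) with `Φ l = X 0`, every other
boundary letter `Φ l' = v · X l''`, `l'' ≠ 0`, `v` a unit, and `Φ^* f = u · (x₀^o + Σ_{i<o} a_i x₀^i)`, `u` a unit, the `a_i` free of `x₀`. -/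
theorem Decoration.exists_weierstrassWitness_of_letterDir {δ : Decoration k m} {l : Fin (m + 1)} (hf : δ.f ≠ 0) (ho : δ.o ≠ 0)
    (hL : δ.LetterDir l) :
    ∃ (Φ : Fin (m + 1) → MvPowerSeries (Fin (m + 1)) k) (u : MvPowerSeries (Fin (m + 1)) k) (a : ℕ → MvPowerSeries (Fin (m + 1)) k),
      (∀ i, constantCoeff (Φ i) = 0) ∧
      IsUnit (Matrix.det (Matrix.of fun i j : Fin (m + 1) => coeff (Finsupp.single j 1) (Φ i))) ∧
      Φ l = X 0 ∧
      (∀ l' ∈ δ.E, l' ≠ l → ∃ (l'' : Fin (m + 1)) (v : MvPowerSeries (Fin (m + 1)) k), l'' ≠ 0 ∧ constantCoeff v ≠ 0 ∧ Φ l' = v * X l'') ∧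
      constantCoeff u ≠ 0 ∧ (∀ i (n : Fin (m + 1) →₀ ℕ), n 0 ≠ 0 → coeff n (a i) = 0) ∧
      subst Φ δ.f = u * (X 0 ^ δ.o + ∑ i ∈ Finset.range δ.o, a i * X 0 ^ i) := by
  obtain ⟨Φ, h0, hdet, hl, hE, hord, hreg⟩ := Decoration.exists_regularMove_of_letterDir hL ho
  have hfo : δ.f.order = (δ.o : ℕ∞) := by
    rw [Decoration.o, ENat.coe_toNat]
    rw [ne_eq, order_eq_top_iff]
    exact hf
  have hlow : ∀ i < δ.o, coeff (Finsupp.single 0 i) (subst Φ δ.f) = 0 := by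
    intro i hi
    apply coeff_of_lt_order
    rw [hord, hfo, Finsupp.degree_single]
    exact_mod_cast hi
  obtain ⟨u, a, hu, ha, hW⟩ := exists_weierstrass_of_regular hlow hreg
  exact ⟨Φ, u, a, h0, hdet, hl, hE, hu, ha, hW⟩

end TameFourTupleDrop

end Summit.ResolutionOfSingularities.ResolutionOfSingularities.Theorems

end
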